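import Summits.BirchSwinnertonDyer.BirchSwinnertonDyer.Theorems.ByReductionTypeAtTwoMultTowerNS2LayerNormGroup
import HarnessLib

/-!
# Route `ByReductionTypeAtTwo`, crux `MultUpperHalfAtTwo` (item stmt-BirchSwinnertonDyer-19922), TOWER road, the
# «ONE BIT AT A NON-SPLIT 2» rows: KERNEL BRICK 15 — cosets of the local layer subgroups by a topological generator,
# finite levels, «orbit product = norm», and the RELATIVE tower non-norm lemma `q^{2^{R−1}a} ∉ N(F_{n+R}/F_n)`

HONEST FRAMING (cell `bsd-2adic`, run/shared/lean/pub/bsd-2adic/, seat `bsd-2adic-tower-1` GEN 9, HUMAN RULINGS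
D-0036 / D-0054 / D-0074): TOOL theorems only (no definition, no named fact, no `sorry`); closes nothing by itself;
nothing booked; BSD is not proved by any of this. Modules M5/M6 of the KERNELISATION of the MEMO binder
`MultTowerNS2.localTowerKerTwoTorsion_le_two_nonsplitTwo_of_tateUnit` (scope memo HOME/tower/SCOPE-hNS2one-kernel-GEN8.md).
Setting: `κ` the cyclotomic `ℤ₂`-extension, `v ∋ 2`, `K = ℚ_v`, `Γ = Gal(K̄_v/K)`, `H_m = localSubgroup (κ.layerSubgroup m) K`,
`H_∞ = localSubgroup κ.kerSubgroup K`, `F_m = K̄_v^{H_m}`, and `g ∈ H_n` generating `H_n` topologically together with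
`H_∞` (the binder shape of BRICK 11 `finite_torsionBy_localTowerKerPrimary_and_card_le`).

* `exists_units_kappa_resGal_eq_of_generate` — `κ(res g) = 2^n·u` with `u ∈ ℤ₂ˣ`;
* `exists_pow_inv_mul_mem_localSubgroup_layerSubgroup` — **cosets**: every `h ∈ H_n` is `g^i h'` with `i < 2^R`,
  `h' ∈ H_{n+R}`; `pow_mem_localSubgroup_layerSubgroup_iff` — `g^i ∈ H_{n+R} ↔ 2^R ∣ i`;
* `exists_forall_mem_localSubgroup_layerSubgroup_smul_eq` — **finite level**: an element of `K̄_v` fixed by `H_∞ ∩ S`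
  (`S` closed) is fixed by `H_m ∩ S` for some `m` (compactness of `Γ`);
* `algebraMap_norm_eq_prod_smul` — **orbit product = norm**: for an open subgroup `H` with `fixingSubgroup (K̄^H) = H`
  normal and coset representatives `γ : ι → Γ` of `Γ/H` (`#ι = [K̄^H : K]`), `N_{K̄^H/K}(f) = ∏ γ_k f`;
* `prod_smul_ne_pow_of_tateUnit` — **`∏_{i<2^R} g^i f ≠ q^{2^{R−1}a}` for `f ∈ F_{n+R}`, `a` odd, `R ≥ 1`** (BRICK 14
  at level `n + R` with the representatives `g₀^j g^i` of `Γ/H_{n+R}`, `κ(res g₀) = 1`): the relative tower non-norm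
  lemma of scope S5 in orbit-product form, as consumed by S4.

References: L. Washington, *Introduction to Cyclotomic Fields*, §13.1; J. Neukirch, *ANT* IV §1, V (1.1); scope memo S5.
-/

set_option autoImplicit false
-- the Theorems namespace of this sub repeats the summit name by design (D-0017 nested layout: Summit.<S>.<Sub>)
set_option linter.dupNamespace false

noncomputable section

open scoped Classical IntermediateField

namespace Summit.BirchSwinnertonDyer.BirchSwinnertonDyer.Theorems.MultTowerNS2

open NumberField IsDedekindDomain Field PadicInt Literature.NumberTheory.EllipticCurves
  Literature.NumberTheory.GaloisRepresentations

variable {κ : ZpExtension ℚ 2}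

/-! ### `κ(res g)` for a topological generator, and the cosets of `H_{n+R}` in `H_n` -/

/-- **`κ(res g) = 2^n · u`, `u` a unit**, for `g ∈ H_n` generating `H_n` topologically together with `H_∞` (otherwise
`g ∈ H_{n+1}`, an open subgroup containing `H_∞`, and `H_n ≤ H_{n+1}` contradicts `[H_n : H_{n+1}] = 2`, BRICK 8).
[cite: Washington1997, §13.1] -/
theorem exists_units_kappa_resGal_eq_of_generate (hκ : κ.IsCyclotomic) (v : HeightOneSpectrum (𝓞 ℚ))
    (hv : ((2 : ℕ) : 𝓞 ℚ) ∈ v.asIdeal) (n : ℕ) {g : absoluteGaloisGroup (v.adicCompletion ℚ)}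
    (hg : g ∈ localSubgroup (κ.layerSubgroup n) (v.adicCompletion ℚ))
    (hgen : ∀ U : Subgroup (absoluteGaloisGroup (v.adicCompletion ℚ)),
      IsOpen (U : Set (absoluteGaloisGroup (v.adicCompletion ℚ))) →
        localSubgroup κ.kerSubgroup (v.adicCompletion ℚ) ≤ U → g ∈ U →
          localSubgroup (κ.layerSubgroup n) (v.adicCompletion ℚ) ≤ U) :
    ∃ u : ℤ_[2]ˣ, ((κ (resGal (K := ℚ) (v.adicCompletion ℚ) g)).toAdd : ℤ_[2]) = 2 ^ n * (u : ℤ_[2]) := by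
  rw [mem_localSubgroup_iff, ZpExtension.mem_layerSubgroup] at hg
  obtain ⟨b, hb⟩ := hg
  by_cases hbu : IsUnit b
  · exact ⟨hbu.unit, by rw [IsUnit.unit_spec]; exact_mod_cast hb⟩
  exfalso
  -- `2 ∣ b`, so `g ∈ H_{n+1}`
  have hb1 : ‖b‖ < 1 := lt_of_le_of_ne (PadicInt.norm_le_one b) (fun h ↦ hbu (PadicInt.isUnit_iff.mpr h))
  rw [PadicInt.norm_lt_one_iff_dvd] at hb1
  obtain ⟨c, rfl⟩ := hb1
  have hg1 : g ∈ localSubgroup (κ.layerSubgroup (n + 1)) (v.adicCompletion ℚ) := by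
    rw [mem_localSubgroup_iff, ZpExtension.mem_layerSubgroup]
    refine ⟨c, ?_⟩
    have h : ((κ (resGal (K := ℚ) (v.adicCompletion ℚ) g)).toAdd : ℤ_[2]) = (2 : ℤ_[2]) ^ n * (2 * c) := by
      exact_mod_cast hb
    rw [h]; push_cast; ring
  have hle := hgen _ (isOpen_localSubgroup _ (κ.isOpen_layerSubgroup (n + 1)) _)
    (fun τ hτ ↦ by
      rw [mem_localSubgroup_iff] at hτ ⊢
      exact κ.kerSubgroup_le_layerSubgroup (n + 1) hτ) hg1
  have hidx := relIndex_localSubgroup_layerSubgroup_succ hκ v hv n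
  rw [Subgroup.relIndex_eq_one.mpr hle] at hidx
  exact absurd hidx (by norm_num)

/-- **The cosets of `H_{n+R}` in `H_n` are `g^i H_{n+R}`, `i < 2^R`**: for `g` with `κ(res g) = 2^n u` (`u` a unit) and
`h ∈ H_n` there is `i < 2^R` with `(g^i)⁻¹ h ∈ H_{n+R}` (`κ(res h) = 2^n c`, `i ≡ c u⁻¹ (mod 2^R)`).
[cite: Washington1997, §13.1] -/
theorem exists_pow_inv_mul_mem_localSubgroup_layerSubgroup (v : HeightOneSpectrum (𝓞 ℚ)) (n R : ℕ)
    {g : absoluteGaloisGroup (v.adicCompletion ℚ)} {u : ℤ_[2]ˣ}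
    (hu : ((κ (resGal (K := ℚ) (v.adicCompletion ℚ) g)).toAdd : ℤ_[2]) = 2 ^ n * (u : ℤ_[2]))
    {h : absoluteGaloisGroup (v.adicCompletion ℚ)} (hh : h ∈ localSubgroup (κ.layerSubgroup n) (v.adicCompletion ℚ)) :
    ∃ i : ℕ, i < 2 ^ R ∧ (g ^ i)⁻¹ * h ∈ localSubgroup (κ.layerSubgroup (n + R)) (v.adicCompletion ℚ) := by
  rw [mem_localSubgroup_iff, ZpExtension.mem_layerSubgroup] at hh
  obtain ⟨c, hc⟩ := hh
  set i : ℕ := (toZModPow R (c * ((u⁻¹ : ℤ_[2]ˣ) : ℤ_[2]))).val with hi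
  refine ⟨i, ZMod.val_lt _, ?_⟩
  rw [mem_localSubgroup_iff, ZpExtension.mem_layerSubgroup]
  simp only [map_mul, map_inv, map_pow, toAdd_mul, toAdd_inv, toAdd_pow, hu]
  have hc' : ((κ (resGal (K := ℚ) (v.adicCompletion ℚ) h)).toAdd : ℤ_[2]) = (2 : ℤ_[2]) ^ n * c := by exact_mod_cast hc
  rw [hc']
  -- `c u⁻¹ - i ∈ 2^R ℤ₂`
  have hker : c * ((u⁻¹ : ℤ_[2]ˣ) : ℤ_[2]) - (i : ℤ_[2]) ∈ RingHom.ker (toZModPow (p := 2) R) := by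
    rw [RingHom.mem_ker, map_sub, map_natCast, hi, ZMod.natCast_zmod_val, sub_self]
  rw [ker_toZModPow, Ideal.mem_span_singleton] at hker
  obtain ⟨d, hd⟩ := hker
  refine ⟨(u : ℤ_[2]) * d, ?_⟩
  have hud : c - (i : ℤ_[2]) * (u : ℤ_[2]) = (u : ℤ_[2]) * ((2 : ℤ_[2]) ^ R * d) := by
    have h1 : (u : ℤ_[2]) * (c * ((u⁻¹ : ℤ_[2]ˣ) : ℤ_[2]) - (i : ℤ_[2])) = c - (i : ℤ_[2]) * (u : ℤ_[2]) := by
      rw [mul_sub, ← mul_assoc, mul_comm (u : ℤ_[2]) c, mul_assoc, Units.mul_inv, mul_one, mul_comm]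
    rw [← h1, hd]; push_cast; ring
  rw [nsmul_eq_mul]; push_cast
  linear_combination (2 : ℤ_[2]) ^ n * hud

/-- **`g^i ∈ H_{n+R} ↔ 2^R ∣ i`** for `g` with `κ(res g) = 2^n u`, `u` a unit. [cite: Washington1997, §13.1] -/
theorem pow_mem_localSubgroup_layerSubgroup_iff (v : HeightOneSpectrum (𝓞 ℚ)) (n R : ℕ)
    {g : absoluteGaloisGroup (v.adicCompletion ℚ)} {u : ℤ_[2]ˣ}
    (hu : ((κ (resGal (K := ℚ) (v.adicCompletion ℚ) g)).toAdd : ℤ_[2]) = 2 ^ n * (u : ℤ_[2])) (i : ℕ) :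
    g ^ i ∈ localSubgroup (κ.layerSubgroup (n + R)) (v.adicCompletion ℚ) ↔ 2 ^ R ∣ i := by
  rw [mem_localSubgroup_iff, ZpExtension.mem_layerSubgroup]
  simp only [map_pow, toAdd_pow, hu, nsmul_eq_mul, pow_add]
  have h2n : (2 : ℤ_[2]) ^ n ≠ 0 := pow_ne_zero _ two_ne_zero
  rw [show (i : ℤ_[2]) * ((2 : ℤ_[2]) ^ n * (u : ℤ_[2])) = (2 : ℤ_[2]) ^ n * ((i : ℤ_[2]) * u) by ring]
  push_cast
  rw [mul_dvd_mul_iff_left h2n, Units.dvd_mul_right,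
    show ((i : ℤ_[2])) = ((i : ℤ) : ℤ_[2]) by push_cast; rfl,
    show ((2 : ℤ_[2]) ^ R) = ((2 : ℕ) : ℤ_[2]) ^ R by norm_num, PadicInt.pow_p_dvd_int_iff]
  exact_mod_cast Iff.rfl

/-! ### Finite levels -/

/-- `⋂_m H_m = H_∞`: an element of `Γ_{ℚ_v}` lying in every local layer subgroup lies in the local kernel subgroup
(`κ(res σ)` is divisible by every `2^m`, hence `0`). [cite: Washington1997, §13.1] -/
theorem mem_localSubgroup_kerSubgroup_of_forall (v : HeightOneSpectrum (𝓞 ℚ)) {σ : absoluteGaloisGroup (v.adicCompletion ℚ)}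
    (hσ : ∀ m, σ ∈ localSubgroup (κ.layerSubgroup m) (v.adicCompletion ℚ)) :
    σ ∈ localSubgroup κ.kerSubgroup (v.adicCompletion ℚ) := by
  rw [mem_localSubgroup_iff, ZpExtension.mem_kerSubgroup]
  apply Multiplicative.toAdd.injective
  rw [toAdd_one]
  by_contra hne
  set x : ℤ_[2] := (κ (resGal (K := ℚ) (v.adicCompletion ℚ) σ)).toAdd with hx
  obtain ⟨m, hm⟩ : ∃ m : ℕ, (2 : ℝ) ^ (-(m : ℤ)) < ‖x‖ := by
    have hpos : 0 < ‖x‖ := norm_pos_iff.mpr hne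
    obtain ⟨m, hm⟩ := exists_pow_lt_of_lt_one hpos (by norm_num : (1 / 2 : ℝ) < 1)
    refine ⟨m, ?_⟩
    rw [zpow_neg, zpow_natCast, ← inv_pow, show (2 : ℝ)⁻¹ = 1 / 2 by norm_num]
    exact hm
  have h := hσ m
  rw [mem_localSubgroup_iff, ZpExtension.mem_layerSubgroup, ← Ideal.mem_span_singleton, ← hx,
    ← PadicInt.norm_le_pow_iff_mem_span_pow] at h
  have h' : ‖x‖ ≤ (2 : ℝ) ^ (-(m : ℤ)) := by exact_mod_cast h
  exact absurd (lt_of_lt_of_le hm h') (lt_irrefl _)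

/-- **Finite level**: if `x ∈ K̄_v` is fixed by every element of `H_∞ ∩ S` (`S ≤ Γ` closed), then for some `m` it is
fixed by every element of `H_m ∩ S` — the sets `(H_m ∩ S) ∖ Fix(x)` are compact, decreasing, with empty intersection.
[cite: NeukirchANT1999, Ch. IV §1] -/
theorem exists_forall_mem_localSubgroup_layerSubgroup_smul_eq (v : HeightOneSpectrum (𝓞 ℚ))
    (S : Subgroup (absoluteGaloisGroup (v.adicCompletion ℚ)))
    (hS : IsClosed (S : Set (absoluteGaloisGroup (v.adicCompletion ℚ)))) (x : AlgebraicClosure (v.adicCompletion ℚ))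
    (hx : ∀ h ∈ localSubgroup κ.kerSubgroup (v.adicCompletion ℚ), h ∈ S → h • x = x) :
    ∃ m : ℕ, ∀ h ∈ localSubgroup (κ.layerSubgroup m) (v.adicCompletion ℚ), h ∈ S → h • x = x := by
  -- the open subgroup `U = Gal(K̄/K(x))` of elements fixing `x`
  let H : ℕ → Subgroup (absoluteGaloisGroup (v.adicCompletion ℚ)) :=
    fun m ↦ localSubgroup (κ.layerSubgroup m) (v.adicCompletion ℚ)
  have hHanti : ∀ m, H (m + 1) ≤ H m := fun m ↦ localSubgroup_layerSubgroup_succ_le (κ := κ) v m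
  have hHopen : ∀ m, IsOpen (H m : Set (absoluteGaloisGroup (v.adicCompletion ℚ))) :=
    fun m ↦ isOpen_localSubgroup _ (κ.isOpen_layerSubgroup m) _
  have hHker : ∀ σ : absoluteGaloisGroup (v.adicCompletion ℚ), (∀ m, σ ∈ H m) →
      σ ∈ localSubgroup κ.kerSubgroup (v.adicCompletion ℚ) := fun σ h ↦ mem_localSubgroup_kerSubgroup_of_forall v h
  have hint : IsIntegral (v.adicCompletion ℚ) x := Algebra.IsIntegral.isIntegral x
  haveI : FiniteDimensional (v.adicCompletion ℚ) (v.adicCompletion ℚ)⟮x⟯ := IntermediateField.adjoin.finiteDimensional hint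
  let U : Subgroup (absoluteGaloisGroup (v.adicCompletion ℚ)) := ((v.adicCompletion ℚ)⟮x⟯).fixingSubgroup
  have hUopen : IsOpen (U : Set (absoluteGaloisGroup (v.adicCompletion ℚ))) :=
    IntermediateField.fixingSubgroup_isOpen _
  have hUfix : ∀ σ ∈ U, σ • x = x := fun σ hσ ↦
    (IntermediateField.mem_fixingSubgroup_iff _ _).mp hσ x (IntermediateField.mem_adjoin_simple_self _ x)
  have hfixU : ∀ σ : absoluteGaloisGroup (v.adicCompletion ℚ), σ • x = x → σ ∈ U := by
    intro σ hσ
    have hle : (v.adicCompletion ℚ)⟮x⟯ ≤ IntermediateField.fixedField (Subgroup.zpowers σ) := by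
      rw [IntermediateField.adjoin_simple_le_iff, IntermediateField.mem_fixedField_iff]
      rintro τ ⟨k, rfl⟩
      exact MulAction.mem_stabilizer_iff.mp
        ((MulAction.stabilizer (absoluteGaloisGroup (v.adicCompletion ℚ)) x).zpow_mem
          (MulAction.mem_stabilizer_iff.mpr hσ) k)
    exact (IntermediateField.mem_fixingSubgroup_iff _ _).mpr fun y hy ↦
      (IntermediateField.mem_fixedField_iff _ _).mp (hle hy) σ (Subgroup.mem_zpowers σ)
  -- the compact sets `(H m ∩ S) \ U`
  by_contra hcon
  have hcon' : ∀ m, ∃ h, h ∈ H m ∧ h ∈ S ∧ h • x ≠ x := by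
    intro m
    by_contra hm
    refine hcon ⟨m, fun h hh hhS ↦ ?_⟩
    by_contra hne
    exact hm ⟨h, hh, hhS, hne⟩
  let t : ℕ → Set (absoluteGaloisGroup (v.adicCompletion ℚ)) := fun m ↦ ((H m : Set _) ∩ (S : Set _)) \ (U : Set _)
  have htd : ∀ m, t (m + 1) ⊆ t m := fun m σ hσ ↦ ⟨⟨hHanti m hσ.1.1, hσ.1.2⟩, hσ.2⟩
  have htn : ∀ m, (t m).Nonempty := by
    intro m
    obtain ⟨h, hh, hhS, hne⟩ := hcon' m
    exact ⟨h, ⟨hh, hhS⟩, fun hU ↦ hne (hUfix h hU)⟩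
  have htcl : ∀ m, IsClosed (t m) := fun m ↦
    (((H m).isClosed_of_isOpen (hHopen m)).inter hS).sdiff hUopen
  -- (`CharZero ℚ_v` enters the context only now, for the compactness of `Γ`; see BRICK 14 for why)
  haveI : CharZero (v.adicCompletion ℚ) :=
    charZero_of_injective_algebraMap (algebraMap ℚ (v.adicCompletion ℚ)).injective
  obtain ⟨σ, hσ⟩ := IsCompact.nonempty_iInter_of_sequence_nonempty_isCompact_isClosed t htd htn
    (htcl 0).isCompact htcl
  rw [Set.mem_iInter] at hσ
  have hσS : σ ∈ S := (hσ 0).1.2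
  have hσU : σ ∉ U := (hσ 0).2
  have hσi := hHker σ fun m ↦ (hσ m).1.1
  exact hσU (hfixU σ (hx σ hσi hσS))

/-! ### Orbit product = norm -/

/-- **Orbit product = norm.** Let `E ⊆ K̄` be a finite Galois subextension of `K = ℚ_v` whose fixing subgroup is `H`,
and `γ : ι → Γ` representatives of ALL cosets of `H` in `Γ = Gal(K̄/K)` with `#ι = [E : K]`. Then for `f ∈ E`:
`N_{E/K}(f) = ∏_k γ_k(f)` in `K̄` (Mathlib `Algebra.norm_eq_prod_automorphisms` and `Gal(E/K) ≅ Γ/H`).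
[cite: NeukirchANT1999, Ch. IV §1] -/
theorem algebraMap_norm_eq_prod_smul (v : HeightOneSpectrum (𝓞 ℚ))
    (E : IntermediateField (v.adicCompletion ℚ) (AlgebraicClosure (v.adicCompletion ℚ)))
    [FiniteDimensional (v.adicCompletion ℚ) E] [IsGalois (v.adicCompletion ℚ) E]
    {H : Subgroup (absoluteGaloisGroup (v.adicCompletion ℚ))}
    (hH : ∀ σ : absoluteGaloisGroup (v.adicCompletion ℚ), σ ∈ E.fixingSubgroup ↔ σ ∈ H)
    {ι : Type*} [Fintype ι] (γ : ι → absoluteGaloisGroup (v.adicCompletion ℚ))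
    (hcov : ∀ σ : absoluteGaloisGroup (v.adicCompletion ℚ), ∃ k, σ⁻¹ * γ k ∈ H)
    (hcard : Fintype.card ι = Module.finrank (v.adicCompletion ℚ) E) (f : E) :
    algebraMap (v.adicCompletion ℚ) (AlgebraicClosure (v.adicCompletion ℚ)) (Algebra.norm (v.adicCompletion ℚ) f) =
      ∏ k, γ k • (f : AlgebraicClosure (v.adicCompletion ℚ)) := by
  have hprod := Algebra.norm_eq_prod_automorphisms (v.adicCompletion ℚ) (L := E) f
  have h1 : algebraMap (v.adicCompletion ℚ) (AlgebraicClosure (v.adicCompletion ℚ)) (Algebra.norm (v.adicCompletion ℚ) f) =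
      ((algebraMap (v.adicCompletion ℚ) E (Algebra.norm (v.adicCompletion ℚ) f) : E) :
        AlgebraicClosure (v.adicCompletion ℚ)) := by
    rw [IsScalarTower.algebraMap_apply (v.adicCompletion ℚ) E (AlgebraicClosure (v.adicCompletion ℚ))]
    rfl
  rw [h1, hprod, IntermediateField.coe_prod]
  -- the bijection `ι → Gal(E/K)`, `k ↦ restriction of γ k`
  let Θ : ι → (E ≃ₐ[v.adicCompletion ℚ] E) := fun k ↦ AlgEquiv.restrictNormalHom E (γ k)
  have hker : ∀ σ : absoluteGaloisGroup (v.adicCompletion ℚ), AlgEquiv.restrictNormalHom E σ = 1 ↔ σ ∈ H :=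
    fun σ ↦ (MonoidHom.mem_ker (f := AlgEquiv.restrictNormalHom E)).symm.trans
      ((SetLike.ext_iff.mp (IntermediateField.restrictNormalHom_ker E) σ).trans (hH σ))
  have hsurj : Function.Surjective Θ := by
    intro τ
    obtain ⟨σ, hσ⟩ := AlgEquiv.restrictNormalHom_surjective (AlgebraicClosure (v.adicCompletion ℚ)) τ
    let σ' : absoluteGaloisGroup (v.adicCompletion ℚ) := σ
    obtain ⟨k, hk⟩ := hcov σ'
    refine ⟨k, ?_⟩
    have h1 : AlgEquiv.restrictNormalHom E (σ'⁻¹ * γ k) = 1 := (hker _).mpr hk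
    have hm : AlgEquiv.restrictNormalHom E σ'⁻¹ * AlgEquiv.restrictNormalHom E (γ k) = 1 :=
      (map_mul (AlgEquiv.restrictNormalHom E) σ'⁻¹ (γ k)).symm.trans h1
    have hi : (AlgEquiv.restrictNormalHom E σ')⁻¹ * AlgEquiv.restrictNormalHom E (γ k) = 1 :=
      (congrArg (· * AlgEquiv.restrictNormalHom E (γ k)) (map_inv (AlgEquiv.restrictNormalHom E) σ')).symm.trans hm
    have h2 : AlgEquiv.restrictNormalHom E σ' = AlgEquiv.restrictNormalHom E (γ k) := inv_mul_eq_one.mp hi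
    exact h2.symm.trans hσ
  have hbij : Function.Bijective Θ := by
    rw [Fintype.bijective_iff_surjective_and_card]
    refine ⟨hsurj, ?_⟩
    rw [hcard, ← IsGalois.card_aut_eq_finrank, Nat.card_eq_fintype_card]
  rw [← hbij.prod_comp]
  refine Finset.prod_congr rfl fun k _ ↦ ?_
  change ((AlgEquiv.restrictNormalHom E (γ k) f : E) : AlgebraicClosure (v.adicCompletion ℚ)) = _
  rw [AlgEquiv.restrictNormalHom_apply]
  rfl

/-! ### The relative tower non-norm lemma in orbit-product form -/

/-- **`∏_{i<2^R} g^i(f) ≠ q^{2^{R−1}a}` for `f ∈ F_{n+R}`, `a` odd, `R ≥ 1`.** Here `κ` is the cyclotomic `ℤ₂`-extension,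
`v ∋ 2`, `g ∈ Γ_{ℚ_v}` with `κ(res g) = 2^n u_g` (a topological generator of `H_n` modulo `H_∞`), `e : ℚ_v ≃ ℚ₂` a ring
isomorphism and `q ∈ ℚ_v` with `e q = 2^k u`, `u ≡ 3, 5 (mod 8)` (the Tate parameter). With `g₀`, `κ(res g₀) = 1`, the
elements `g₀^j g^i` (`j < 2^n`, `i < 2^R`) represent `Γ/H_{n+R}`, so `N_{F_{n+R}/ℚ_v}(f) = ∏_j g₀^j(∏_i g^i f)`; if the
inner product were `q^{2^{R−1}a} ∈ ℚ_v` the norm would be `q^{2^{n+R−1}a}`, contradicting BRICK 14 `norm_ne_pow_of_tateUnit`.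
This is `q^{2^{R−1}a} ∉ N(F_{n+R}/F_n)` (scope memo S5) in the form consumed by S4. [cite: NeukirchANT1999, Ch. V §1 Thm. (1.1)] -/
theorem prod_smul_ne_pow_of_tateUnit (hκ : κ.IsCyclotomic) (v : HeightOneSpectrum (𝓞 ℚ))
    (hv : ((2 : ℕ) : 𝓞 ℚ) ∈ v.asIdeal) (p : ℕ) [Fact p.Prime] (hp : p = 2)
    (e : v.adicCompletion ℚ ≃+* ℚ_[p]) {q : v.adicCompletion ℚ} {k : ℕ} {u : ℤ_[p]}
    (hq : e q = (p : ℚ_[p]) ^ k * (u : ℚ_[p])) (hu : toZModPow 3 u = 3 ∨ toZModPow 3 u = 5)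
    (n : ℕ) {g : absoluteGaloisGroup (v.adicCompletion ℚ)} {ug : ℤ_[2]ˣ}
    (hug : ((κ (resGal (K := ℚ) (v.adicCompletion ℚ) g)).toAdd : ℤ_[2]) = 2 ^ n * (ug : ℤ_[2]))
    {R : ℕ} (hR : 1 ≤ R) {a : ℕ} (ha : Odd a) {f : AlgebraicClosure (v.adicCompletion ℚ)}
    (hf : ∀ h ∈ localSubgroup (κ.layerSubgroup (n + R)) (v.adicCompletion ℚ), h • f = f) :
    (∏ i ∈ Finset.range (2 ^ R), (g ^ i) • f) ≠
      algebraMap (v.adicCompletion ℚ) (AlgebraicClosure (v.adicCompletion ℚ)) (q ^ (2 ^ (R - 1) * a)) := by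
  intro hprod
  -- a local element `g₀` with `κ(res g₀) = 1`, and the representatives `g₀^j g^i` of `Γ/H_{n+R}`
  obtain ⟨g₀, hg₀'⟩ := surjective_kappa_comp_resGal hκ v hv (Multiplicative.ofAdd (1 : ℤ_[2]))
  have hg₀ : ((κ (resGal (K := ℚ) (v.adicCompletion ℚ) g₀)).toAdd : ℤ_[2]) = 2 ^ 0 * ((1 : ℤ_[2]ˣ) : ℤ_[2]) := by
    have h := congrArg Multiplicative.toAdd hg₀'
    rw [toAdd_ofAdd] at h
    rw [pow_zero, Units.val_one, one_mul]
    exact h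
  have hcov : ∀ σ : absoluteGaloisGroup (v.adicCompletion ℚ), ∃ ji : Fin (2 ^ n) × Fin (2 ^ R),
      σ⁻¹ * (g₀ ^ (ji.1 : ℕ) * g ^ (ji.2 : ℕ)) ∈ localSubgroup (κ.layerSubgroup (n + R)) (v.adicCompletion ℚ) := by
    intro σ
    have hσ0 : σ ∈ localSubgroup (κ.layerSubgroup 0) (v.adicCompletion ℚ) := by
      rw [mem_localSubgroup_iff, ZpExtension.mem_layerSubgroup, pow_zero]
      exact one_dvd _
    obtain ⟨j, hj, hjσ⟩ := exists_pow_inv_mul_mem_localSubgroup_layerSubgroup (κ := κ) v 0 n hg₀ hσ0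
    rw [Nat.zero_add] at hjσ
    obtain ⟨i, hi, hiσ⟩ := exists_pow_inv_mul_mem_localSubgroup_layerSubgroup (κ := κ) v n R hug hjσ
    refine ⟨(⟨j, hj⟩, ⟨i, hi⟩), ?_⟩
    have h := Subgroup.inv_mem _ hiσ
    have heq : ((g ^ i)⁻¹ * ((g₀ ^ j)⁻¹ * σ))⁻¹ = σ⁻¹ * (g₀ ^ j * g ^ i) := by group
    rw [heq] at h
    exact h
  -- the fixed field `F_{n+R}` and `f` as its element
  haveI := finiteDimensional_fixedField_localSubgroup_layerSubgroup (κ := κ) v (n + R)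
  haveI := isGalois_fixedField_localSubgroup_layerSubgroup (κ := κ) v (n + R)
  have hrank := finrank_fixedField_localSubgroup_layerSubgroup hκ v hv (n + R)
  have hopen := isOpen_localSubgroup (κ.layerSubgroup (n + R)) (κ.isOpen_layerSubgroup (n + R)) (v.adicCompletion ℚ)
  let f' : IntermediateField.fixedField (localSubgroup (κ.layerSubgroup (n + R)) (v.adicCompletion ℚ)) :=
    ⟨f, (IntermediateField.mem_fixedField_iff _ _).mpr fun h hh ↦ hf h hh⟩
  have hne := norm_ne_pow_of_tateUnit hκ v hv (m := n + R) (by omega) p hp e hq hu ha f'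
  have hcard : Fintype.card (Fin (2 ^ n) × Fin (2 ^ R)) = Module.finrank (v.adicCompletion ℚ)
      (IntermediateField.fixedField (localSubgroup (κ.layerSubgroup (n + R)) (v.adicCompletion ℚ))) := by
    rw [hrank, Fintype.card_prod, Fintype.card_fin, Fintype.card_fin, pow_add]
  -- (`CharZero ℚ_v` only now: it changes the preferred `Algebra ℚ ℚ_v` instance, see BRICK 14)
  haveI : CharZero (v.adicCompletion ℚ) :=
    charZero_of_injective_algebraMap (algebraMap ℚ (v.adicCompletion ℚ)).injective
  have hfix := fixingSubgroup_fixedField_of_isOpen _ hopen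
  have hH := fun σ ↦ SetLike.ext_iff.mp hfix σ
  have hnorm := algebraMap_norm_eq_prod_smul v _ hH (fun ji : Fin (2 ^ n) × Fin (2 ^ R) ↦ g₀ ^ (ji.1 : ℕ) * g ^ (ji.2 : ℕ))
    hcov hcard f'
  -- `∏_{j,i} g₀^j g^i f = ∏_j g₀^j (q^N) = q^{N 2^n}`
  have hinner : ∀ j : Fin (2 ^ n), (∏ i : Fin (2 ^ R), (g₀ ^ (j : ℕ) * g ^ (i : ℕ)) •
      (f' : AlgebraicClosure (v.adicCompletion ℚ))) =
        algebraMap (v.adicCompletion ℚ) (AlgebraicClosure (v.adicCompletion ℚ)) (q ^ (2 ^ (R - 1) * a)) := by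
    intro j
    have h1 : (∏ i : Fin (2 ^ R), (g₀ ^ (j : ℕ) * g ^ (i : ℕ)) • (f' : AlgebraicClosure (v.adicCompletion ℚ))) =
        g₀ ^ (j : ℕ) • ∏ i ∈ Finset.range (2 ^ R), (g ^ i) • f := by
      rw [← Fin.prod_univ_eq_prod_range (fun i ↦ (g ^ i) • f) (2 ^ R), Finset.smul_prod']
      refine Finset.prod_congr rfl fun i _ ↦ ?_
      rw [mul_smul]
    rw [h1, hprod]
    exact AlgEquiv.commutes (absoluteGaloisGroup.toAlgEquiv _ (g₀ ^ (j : ℕ))) _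
  rw [Fintype.prod_prod_type, Finset.prod_congr rfl (fun j _ ↦ hinner j), Finset.prod_const, Finset.card_univ,
    Fintype.card_fin, ← map_pow, ← pow_mul] at hnorm
  have hNe : Algebra.norm (v.adicCompletion ℚ) f' = q ^ (2 ^ (R - 1) * a * 2 ^ n) :=
    (algebraMap (v.adicCompletion ℚ) (AlgebraicClosure (v.adicCompletion ℚ))).injective hnorm
  have hexp : 2 ^ (R - 1) * a * 2 ^ n = 2 ^ (n + R - 1) * a := by
    rw [show n + R - 1 = n + (R - 1) by omega, pow_add]; ring
  rw [hexp] at hNe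
  exact hne hNe

end Summit.BirchSwinnertonDyer.BirchSwinnertonDyer.Theorems.MultTowerNS2

end
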